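import Literature.Geometry.Riemannian.ShrinkerHamiltonIveyPoint
import Literature.Geometry.Riemannian.HamiltonIveyShrinkerAlgebra
import Literature.Geometry.Riemannian.ThreeShrinkerCompactReduction
import Literature.Geometry.Riemannian.BakryEmeryHeatFlow
import Literature.Geometry.Lorentzian.CoordOrthonormalEigenframe
import Literature.Geometry.Lorentzian.CoordRicciNonnegOfPinching
import HarnessLib

/-!
# The elliptic Hamilton–Ivey estimate on a three-dimensional shrinker: the chart step

Second layer of the elliptic proof that complete three-dimensional gradient shrinking Ricci
solitons have non-negative sectional curvature (B.-L. Chen, J. Differential Geom. 82 (2009),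
Cor. 2.4 for shrinkers; pinching quantity of Hamilton 1995, §24, Thm. 24.4 / Ivey 1993). On a
three-dimensional Riemannian manifold `(M, g)` with a smooth `f`, `Ric + Hess f = ½ g`,
`R + |∇f|² = f` and `R ≥ 0`, let `Λ` bound the Ricci form (`Ric_y(w,w) ≤ Λ(y)|w|²`) and be the least
such bound at a point `p`; put `X = 2Λ − R` and `w = X e^{−R/X}` (the Hamilton–Ivey quantity,
`X = −2 sect_min`). If `Θ ≥ 0` is `C²`, `Θ(f) w ≤ M` wherever `X > 0`, and at `p`:
`X(p) > 0`, `Θ(f(p)) > 0`, `Θ(f(p)) w(p) = M` (a maximum point of `Θ(f)·w`), then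

* **`HamiltonIvey.chart_step`**:
  `Θ(f p)(1 + X(p)) ≤ −(Θ''(f p)|∇f|²(p) + Θ'(f p)(3/2 − f(p))) + 2Θ'(f p)²|∇f|²(p)/Θ(f p)`.

PROOF. Read everything in the chart at `p` (`chartRep`, `soliton_chartRep_target`, the
dictionary `ricci_chartInv_mfderiv_eq_ricAt`, `val_chartInv_mfderiv_eq_chartRep`,
`scalarCurvature_chartInv_eq`, `gradSq_chartInv_eq`); take an orthonormal eigenframe of `Ric_p`
with top eigenvalue `μ₀ = Λ(p)` (`exists_orthonormal_eigenframe`, `ricAt_le_of_eigenframe_le`: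
here the top eigenvalue bounds `Ric`, and `Λ(p)` is the least bound); the tangent plane of the
convex `Ω(X,R) = Xe^{−R/X}` at `(X(p), R(p))` (`HamiltonIvey.tangent_le`, `tangent_nonpos`,
`mul_exp_mono`) turns `Θ(f) w ≤ M` into the cut-off affine pinching hypothesis of
`IsMetricOn.hamiltonIvey_at_cutoff_maximum`; its conclusion, the cubic inequality
`HamiltonIvey.key_ineq` and `R + |∇f|² = f` give the claim after division by `Ω₀ > 0`.
Everything is proved; no definition is introduced.

## References

* B.-L. Chen, *Strong uniqueness of the Ricci flow*, J. Differential Geom. 82 (2009), Cor. 2.4. [Chen2009]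
* R. S. Hamilton, *The formation of singularities in the Ricci flow* (1995), §24, Thm. 24.4. [Hamilton1995]
* T. Ivey, *Ricci solitons on compact three-manifolds*, Diff. Geom. Appl. 3 (1993). [Ivey1993]
-/

noncomputable section

set_option maxSynthPendingDepth 3

open Set Filter Module
open scoped Manifold ContDiff Topology

namespace Literature.Geometry.Riemannian

open Lorentzian Lorentzian.PseudoRiemannianMetric

variable {E : Type*} [NormedAddCommGroup E] [NormedSpace ℝ E] [FiniteDimensional ℝ E]
  [CompleteSpace E]
  {H : Type*} [TopologicalSpace H] {I : ModelWithCorners ℝ E H} [I.Boundaryless]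
  {M : Type*} [TopologicalSpace M] [ChartedSpace H M] [IsManifold I ∞ M]
  (g : PseudoRiemannianMetric I ∞ E (TangentSpace I : M → Type _)) [g.HasLeviCivita]

namespace HamiltonIvey

/-- **The chart step of the elliptic Hamilton–Ivey estimate** (see the module docstring): at a
positive maximum point `p` of `Θ(f)·X e^{−R/X}`, `X = 2Λ − R > 0`,
`Θ(f p)(1 + X(p)) ≤ −(Θ''(f p)|∇f|²(p) + Θ'(f p)(3/2 − f p)) + 2Θ'(f p)²|∇f|²(p)/Θ(f p)`.
[cite: Hamilton1995, §24, Thm. 24.4] [cite: Chen2009, Cor. 2.4] [cite: Ivey1993, Thm. 1] -/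
theorem chart_step (hg : g.IsRiemannian) (h3 : finrank ℝ E = 3) {f : M → ℝ}
    (hf : ContMDiff I 𝓘(ℝ, ℝ) ∞ f)
    (hsol : ∀ (x : M) (X Y : TangentSpace I x),
      g.ricci x X Y + g.hessian f x X Y = (1 / 2 : ℝ) * g.val x X Y)
    (hnorm : ∀ x : M, g.scalarCurvature x + g.gradSq f x = f x)
    (hR0 : ∀ x : M, 0 ≤ g.scalarCurvature x)
    (Λ : M → ℝ) (hΛ : ∀ (y : M) (w : TangentSpace I y), g.ricci y w w ≤ Λ y * g.val y w w)
    (p : M) (hΛp : ∀ c : ℝ, (∀ w : TangentSpace I p, g.ricci p w w ≤ c * g.val p w w) → Λ p ≤ c)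
    {Θ Θ' Θ'' : ℝ → ℝ} (hΘ : ∀ t, HasDerivAt Θ (Θ' t) t) (hΘ' : ∀ t, HasDerivAt Θ' (Θ'' t) t)
    (hΘnn : ∀ t, 0 ≤ Θ t) {Mx : ℝ}
    (hbound : ∀ y : M, 0 < 2 * Λ y - g.scalarCurvature y →
      Θ (f y) * ((2 * Λ y - g.scalarCurvature y) *
        Real.exp (-g.scalarCurvature y / (2 * Λ y - g.scalarCurvature y))) ≤ Mx)
    (hXp : 0 < 2 * Λ p - g.scalarCurvature p)
    (hmax : Θ (f p) * ((2 * Λ p - g.scalarCurvature p) *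
        Real.exp (-g.scalarCurvature p / (2 * Λ p - g.scalarCurvature p))) = Mx)
    (hΘp : 0 < Θ (f p)) :
    Θ (f p) * (1 + (2 * Λ p - g.scalarCurvature p)) ≤
      -(Θ'' (f p) * g.gradSq f p + Θ' (f p) * (3 / 2 - f p))
        + 2 * Θ' (f p) ^ 2 * g.gradSq f p / Θ (f p) := by
  classical
  -- ### chart data at `p`
  set G := chartRep I (fun _ ↦ g) p 0 with hGdef
  have hGm : MetricCoord.IsMetricOn G (extChartAt I p).target :=
    Lorentzian.OpensChart.isMetricOn_repr (val_chartPullback_eq_chartRep (fun _ : ℝ ↦ g) p 0)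
  have hpos : ∀ y ∈ (extChartAt I p).target, ∀ w : E, w ≠ 0 → 0 < G y w w := by
    intro y hy w hw
    rw [show y = ((⟨y, hy⟩ : chartTarget I p) : E) from rfl, hGdef, chartRep_apply]
    exact chartPullback_pos g p ⟨y, hy⟩ (fun w' hw' ↦ hg _ w' hw') w hw
  set fr : E → ℝ := f ∘ (extChartAt I p).symm with hfrdef
  have hfrep : ContDiffOn ℝ ∞ fr (extChartAt I p).target := by
    rw [hfrdef, ← contMDiffOn_iff_contDiffOn]
    exact hf.comp_contMDiffOn (contMDiffOn_extChartAt_symm p)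
  have hsolc : ∀ y ∈ (extChartAt I p).target, ∀ v w : E,
      MetricCoord.ricAt G y v w + MetricCoord.hessAt G fr y v w = (1 / 2 : ℝ) * G y v w :=
    soliton_chartRep_target g p hf hsol
  have hu₀ : extChartAt I p p ∈ (extChartAt I p).target := mem_extChartAt_target p
  set u₀ : chartTarget I p := ⟨extChartAt I p p, hu₀⟩ with hu₀def
  have hpu : chartInv I p u₀ = p := extChartAt_to_inv p
  -- the dictionary at a point `u` of the chart target and a model vector `v`
  have hdict : ∀ (u : chartTarget I p) (v : E),
      G u v v = g.val (chartInv I p u) (mfderiv 𝓘(ℝ, E) I (chartInv I p) u v)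
          (mfderiv 𝓘(ℝ, E) I (chartInv I p) u v) ∧
        MetricCoord.ricAt G u v v = g.ricci (chartInv I p u)
          (mfderiv 𝓘(ℝ, E) I (chartInv I p) u v) (mfderiv 𝓘(ℝ, E) I (chartInv I p) u v) ∧
        MetricCoord.scalAt G u = g.scalarCurvature (chartInv I p u) ∧
        fr u = f (chartInv I p u) := fun u v ↦
    ⟨(val_chartInv_mfderiv_eq_chartRep g p u v v).symm,
      (ricci_chartInv_mfderiv_eq_ricAt g p u v v).symm,
      (Lorentzian.scalarCurvature_chartInv_eq g p u).symm, rfl⟩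
  have hfdiff : MDifferentiableAt I 𝓘(ℝ, ℝ) f (chartInv I p u₀) :=
    (hf.of_le (WithTop.coe_le_coe.mpr le_top) : ContMDiff I 𝓘(ℝ, ℝ) 1 f).mdifferentiableAt
      one_ne_zero
  have hgrad : fderiv ℝ fr u₀ (MetricCoord.sharpAt G u₀ (fderiv ℝ fr u₀)) = g.gradSq f p := by
    rw [← MetricCoord.gradSqAt_apply, hfrdef, hGdef, ← gradSq_chartInv_eq g p u₀ hfdiff, hpu]
  -- ### an orthonormal eigenframe of `Ric_p` with the top eigenvalue first
  have hs := hGm.symm _ hu₀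
  have hi := hGm.isInvertible _ hu₀
  obtain ⟨e', μ', he', hμ'⟩ := MetricCoord.exists_orthonormal_eigenframe hs (hpos _ hu₀)
    (MetricCoord.ricAt G u₀) (fun v w ↦ hGm.ricAt_comm hu₀ v w)
  set e'' : Basis (Fin 3) ℝ E := e'.reindex (finCongr h3) with he''def
  set μ'' : Fin 3 → ℝ := μ' ∘ (finCongr h3).symm with hμ''def
  have he''on : ∀ i j, G u₀ (e'' i) (e'' j) = if i = j then 1 else 0 := fun i j ↦ by
    rw [he''def, Basis.reindex_apply, Basis.reindex_apply, he']
    simp only [finCongr_symm, finCongr_apply, Fin.cast_inj]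
  have hμ''ev : ∀ i w, MetricCoord.ricAt G u₀ (e'' i) w = μ'' i * G u₀ (e'' i) w := fun i w ↦ by
    rw [he''def, Basis.reindex_apply, hμ', hμ''def, Function.comp_apply]
  obtain ⟨j, -, hj⟩ := Finset.exists_max_image Finset.univ μ'' Finset.univ_nonempty
  obtain ⟨σ, hσ0, -⟩ := exists_perm_fin_three j μ''
  set e : Basis (Fin 3) ℝ E := e''.reindex σ.symm with hedef
  set μ : Fin 3 → ℝ := μ'' ∘ σ with hμdef
  have hei : ∀ i, e i = e'' (σ i) := fun i ↦ by
    rw [hedef, Basis.reindex_apply, Equiv.symm_symm]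
  have he : ∀ i k, G u₀ (e i) (e k) = if i = k then 1 else 0 := fun i k ↦ by
    rw [hei i, hei k, he''on]
    simp only [EmbeddingLike.apply_eq_iff_eq]
  have hμ : ∀ i w, MetricCoord.ricAt G u₀ (e i) w = μ i * G u₀ (e i) w := fun i w ↦ by
    rw [hei i, hμ''ev, hμdef, Function.comp_apply]
  have htop : ∀ i, μ i ≤ μ 0 := fun i ↦ by
    rw [hμdef, Function.comp_apply, Function.comp_apply, hσ0]
    exact hj _ (Finset.mem_univ _)
  have he00 : G u₀ (e 0) (e 0) = 1 := by rw [he]; simp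
  -- `S(p) = μ₀ + μ₁ + μ₂` and `Λ(p) = μ₀`
  have hSsum : MetricCoord.scalAt G u₀ = μ 0 + μ 1 + μ 2 := by
    rw [MetricCoord.scalAt_eq_sum_of_eigenframe e he hμ hi, Fin.sum_univ_three]
  have hRp : g.scalarCurvature p = μ 0 + μ 1 + μ 2 := by
    rw [← hSsum, (hdict u₀ (e 0)).2.2.1, hpu]
  have hΛeq : Λ p = μ 0 := by
    apply le_antisymm
    · -- every `Ric_p(w,w) ≤ μ₀ |w|²`: read `w = dΦ v` in the chart
      have hQ : (fun x : M ↦ ∀ w : TangentSpace I x, g.ricci x w w ≤ μ 0 * g.val x w w)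
          (chartInv I p u₀) := by
        intro w
        have hinj := injective_mfderiv_chartInv (I := I) p u₀
        have hinv := isInvertible_mfderiv_of_injective rfl hinj
        set L := mfderiv 𝓘(ℝ, E) I (chartInv I p) u₀ with hL
        obtain ⟨v, hv⟩ : ∃ v : E, L v = w :=
          ⟨L.inverse w, by rw [← ContinuousLinearMap.comp_apply, hinv.self_comp_inverse]; rfl⟩
        have h1 := MetricCoord.ricAt_le_of_eigenframe_le e he hμ
          (fun v w ↦ hGm.ricAt_comm hu₀ v w) htop v
        rw [(hdict u₀ v).1, (hdict u₀ v).2.1] at h1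
        rw [← hv]
        exact h1
      rw [hpu] at hQ
      exact hΛp (μ 0) hQ
    · have h1 := hΛ (chartInv I p u₀) (mfderiv 𝓘(ℝ, E) I (chartInv I p) u₀ (e 0))
      rw [← (hdict u₀ (e 0)).1, ← (hdict u₀ (e 0)).2.1, hμ, he00, mul_one, mul_one, hpu] at h1
      exact h1
  -- ### the constants of the tangent plane
  obtain key := HamiltonIvey.key_ineq (μ 1) (μ 2) (μ 0) (htop 1) (htop 2)
    (by rw [hΛeq, hRp] at hXp; linarith)
  set X₀ : ℝ := μ 0 - μ 1 - μ 2 with hX₀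
  set R₀ : ℝ := μ 1 + μ 2 + μ 0 with hR₀
  have hX₀pos : 0 < X₀ := by rw [hΛeq, hRp] at hXp; rw [hX₀]; linarith
  have hR₀nn : 0 ≤ R₀ := by rw [hR₀]; linarith [hR0 p, hRp]
  have hXeq : 2 * Λ p - g.scalarCurvature p = X₀ := by rw [hΛeq, hRp, hX₀]; ring
  have hRR : g.scalarCurvature p = R₀ := by rw [hRp, hR₀]; ring
  set q : ℝ := Real.exp (-R₀ / X₀) with hq
  have hqpos : 0 < q := Real.exp_pos _
  set α : ℝ := q * (1 + R₀ / X₀) with hα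
  set κ : ℝ := -α - q with hκ
  set Ω₀ : ℝ := X₀ * q with hΩ₀
  have hΩ₀pos : 0 < Ω₀ := mul_pos hX₀pos hqpos
  set c₀ : ℝ := Ω₀ - 2 * α * μ 0 - κ * MetricCoord.scalAt G u₀ with hc₀
  have hMx : Mx = Θ (f p) * Ω₀ := by rw [← hmax, hXeq, hRR]
  have hMxpos : 0 < Mx := by rw [hMx]; exact mul_pos hΘp hΩ₀pos
  -- ### the cut-off affine pinching on the chart target
  have hle : ∀ y ∈ (extChartAt I p).target, ∀ w : E,
      Θ (fr y) * (c₀ * G y w w + 2 * α * MetricCoord.ricAt G y w w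
        + κ * MetricCoord.scalAt G y * G y w w) ≤ Mx * G y w w := by
    intro y hy w
    by_cases hw : w = 0
    · subst hw
      simp
    set u : chartTarget I p := ⟨y, hy⟩ with hudef
    set z : M := chartInv I p u with hz
    set wv := mfderiv 𝓘(ℝ, E) I (chartInv I p) u w with hwv
    obtain ⟨hval, hric, hscal, hfz⟩ := hdict u w
    have hwv0 : wv ≠ 0 := fun h0 ↦ hw
      (injective_mfderiv_chartInv (I := I) p u (h0.trans (map_zero _).symm))
    have hyu : (y : E) = (u : E) := rfl
    rw [hyu, hval, hric, hscal, hfz]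
    set V := g.val z wv wv with hV
    have hVpos : 0 < V := hg z wv hwv0
    set t := g.ricci z wv wv with ht
    set Rz := g.scalarCurvature z with hRz
    -- the tangent expression
    set Xt : ℝ := 2 * (t / V) - Rz with hXt
    set TE : ℝ := X₀ * Real.exp (-R₀ / X₀) + Real.exp (-R₀ / X₀) * (1 + R₀ / X₀) * (Xt - X₀)
      - Real.exp (-R₀ / X₀) * (Rz - R₀) with hTE
    have hcomb : c₀ * V + 2 * α * t + κ * Rz * V = V * TE := by
      have htV : t = (t / V) * V := by field_simp
      rw [hc₀, hSsum, hTE, hXt, hκ, hα, hΩ₀, ← hq, hR₀, hX₀]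
      conv_lhs => rw [htV]
      ring
    have hLHS : Θ (f z) * (c₀ * V + 2 * α * t + κ * Rz * V) = V * (Θ (f z) * TE) := by
      rw [hcomb]; ring
    rw [hLHS, mul_comm Mx V]
    refine mul_le_mul_of_nonneg_left ?_ hVpos.le
    by_cases hXt0 : Xt ≤ 0
    · have h1 : TE ≤ 0 := HamiltonIvey.tangent_nonpos X₀ R₀ Xt Rz hX₀pos hR₀nn hXt0 (hR0 z)
      exact le_trans (mul_nonpos_iff.2 (Or.inl ⟨hΘnn _, h1⟩)) hMxpos.le
    · push Not at hXt0
      have h1 : TE ≤ Xt * Real.exp (-Rz / Xt) := HamiltonIvey.tangent_le X₀ R₀ Xt Rz hX₀pos hXt0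
      have htΛ : t / V ≤ Λ z := by
        rw [div_le_iff₀ hVpos]
        exact hΛ z wv
      have hXz : Xt ≤ 2 * Λ z - Rz := by rw [hXt]; linarith
      have h2 := HamiltonIvey.mul_exp_mono Rz Xt (2 * Λ z - Rz) (hR0 z) hXt0 hXz
      have h3 := hbound z (lt_of_lt_of_le hXt0 hXz)
      calc Θ (f z) * TE ≤ Θ (f z) * ((2 * Λ z - Rz) * Real.exp (-Rz / (2 * Λ z - Rz))) :=
            mul_le_mul_of_nonneg_left (h1.trans h2) (hΘnn _)
        _ ≤ Mx := h3
  have heq : Θ (fr u₀) * (c₀ + 2 * α * μ 0 + κ * MetricCoord.scalAt G u₀) = Mx := by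
    rw [(hdict u₀ (e 0)).2.2.2, hpu, hMx, hc₀]
    ring
  have hΘp' : 0 < Θ (fr u₀) := by rw [(hdict u₀ (e 0)).2.2.2, hpu]; exact hΘp
  -- ### the point inequality, the cubic inequality, and the normalisation
  have hB := hGm.hamiltonIvey_at_cutoff_maximum hu₀ (hpos _ hu₀) h3 hfrep hsolc e he hμ hΘ hΘ'
    hΘp' hle heq
  rw [(hdict u₀ (e 0)).2.2.2, hpu, hgrad, hSsum] at hB
  have hL₀ : c₀ + 2 * α * μ 0 + κ * (μ 0 + μ 1 + μ 2) = Ω₀ := by rw [hc₀, hSsum]; ring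
  rw [hL₀] at hB
  -- `key` in the present notation (the `set`s above already abbreviate inside `key`)
  have hkey : Ω₀ * (1 + X₀) ≤
      2 * α * (μ 0 - μ 1 * (μ 0 + μ 1 - μ 2) - μ 2 * (μ 0 + μ 2 - μ 1))
        + κ * (μ 0 + μ 1 + μ 2 - 2 * (μ 0 ^ 2 + μ 1 ^ 2 + μ 2 ^ 2)) := by
    have h1 : μ 0 - (μ 1 * (μ 1 + μ 0 - μ 2) + μ 2 * (μ 2 + μ 0 - μ 1)) =
        μ 0 - μ 1 * (μ 0 + μ 1 - μ 2) - μ 2 * (μ 0 + μ 2 - μ 1) := by ring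
    have h2 : R₀ - 2 * (μ 1 ^ 2 + μ 2 ^ 2 + μ 0 ^ 2) =
        μ 0 + μ 1 + μ 2 - 2 * (μ 0 ^ 2 + μ 1 ^ 2 + μ 2 ^ 2) := by rw [hR₀]; ring
    rw [h1, h2] at key
    exact key
  -- the normalisation `R + |∇f|² = f` at `p`
  have hgn : μ 0 + μ 1 + μ 2 + g.gradSq f p = f p := by rw [← hRp]; exact hnorm p
  have hfin : Θ (f p) * (1 + X₀) ≤
      -(Θ'' (f p) * g.gradSq f p + Θ' (f p) * (3 / 2 - f p))
        + 2 * Θ' (f p) ^ 2 * g.gradSq f p / Θ (f p) := by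
    have h1 : Θ (f p) * (Ω₀ * (1 + X₀)) ≤ Θ (f p) *
        (2 * α * (μ 0 - μ 1 * (μ 0 + μ 1 - μ 2) - μ 2 * (μ 0 + μ 2 - μ 1))
          + κ * (μ 0 + μ 1 + μ 2 - 2 * (μ 0 ^ 2 + μ 1 ^ 2 + μ 2 ^ 2))) :=
      mul_le_mul_of_nonneg_left hkey hΘp.le
    have h2 : 3 / 2 - (μ 0 + μ 1 + μ 2) - g.gradSq f p = 3 / 2 - f p := by linarith
    rw [h2] at hB
    have h3' : Θ (f p) * (Ω₀ * (1 + X₀)) ≤ Ω₀ *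
        (-(Θ'' (f p) * g.gradSq f p + Θ' (f p) * (3 / 2 - f p))
          + 2 * Θ' (f p) ^ 2 * g.gradSq f p / Θ (f p)) := by
      have h4 : -Ω₀ * (Θ'' (f p) * g.gradSq f p + Θ' (f p) * (3 / 2 - f p))
          + 2 * Θ' (f p) ^ 2 * g.gradSq f p * Ω₀ / Θ (f p) = Ω₀ *
          (-(Θ'' (f p) * g.gradSq f p + Θ' (f p) * (3 / 2 - f p))
            + 2 * Θ' (f p) ^ 2 * g.gradSq f p / Θ (f p)) := by ring
      rw [h4] at hB
      exact h1.trans hB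
    rw [show Θ (f p) * (Ω₀ * (1 + X₀)) = Ω₀ * (Θ (f p) * (1 + X₀)) by ring] at h3'
    exact le_of_mul_le_mul_left h3' hΩ₀pos
  rwa [hXeq]

end HamiltonIvey

end Literature.Geometry.Riemannian

end
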